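import Summits.HodgeConjecture.HodgeConjecture.Theorems.Ring2TransportWeilTypeGeneralCMField
import Literature.AlgebraicGeometry.Deligne1982.WeilTypeCMHodgeRing
import Literature.AlgebraicGeometry.HodgeTheory.AlgebraicClassesCupAbelianVarietyDiagonal
import HarnessLib

/-!
# Ring 2 · §transport (gen 5, viii-c) — row T6-CM: the GENERAL member of a CM-field Weil family (`[E:ℚ] ≥ 4`)
# from the divisor–Weil endnote, with the cup-closure input DISCHARGED

HONEST FRAMING (page 1, verbatim for the whole cell). Research route conditional on `HC_CM`; not a corollary;
Q11.4-sentence-2 already refuted in dim ≥ 3 (`HodgeTheory/SemiregularityWeakCriterionAbelianCounterexample`,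
`qminus_det_ne_zero`). Every statement below is either a kernel-checked implication between NAMED OPEN HYPOTHESES
(binders, never facts) or a typed target; `HC_CM := Theses.RankFourFaces.CMAbelianHodge` (stmt-HodgeConjecture-3052;
the route item `CMToAbelian` is stmt-HodgeConjecture-16267 — item id corrected gen 6, referee F31; docstring only)
is always an explicit binder `(hCM : …)`. Nothing internally minted is cited as a fact. Unrefereed inputs are labelled.

## What this file adds (row T6-CM of RING2-MAP §transport; recipe of §lit gen 7)

The literature seat (gen 7, `Literature/AlgebraicGeometry/Deligne1982/WeilTypeCMHodgeRing.lean`) typed the print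
statement behind the cell's "general member of a CM-field Weil family" object as the NAMED FACT
`Deligne1982_hodgeRing_weilTypeCM_of_hodgeGroupSU` (#24; Deligne LNM 900 §4 (4.4) with MILNE'S ENDNOTE 16 of the 2003
re-edition — an UNREFEREED editorial endnote for general CM fields `E`; the quadratic case is refereed, van Geemen
Thm. 6.12): for `(A, E = ℚ(η))` of Weil type with Hodge group `SU` at a Rosati-compatible polarization, every rational
`(p,p)`-class lies in the subalgebra `divisorWeilAlgebra` generated by divisor classes and the Weil classes `W_E ⊗ ℂ`.
Its closing corollary `….hodgeConjectureFor` carries two typed hypotheses: `hcup` (the algebraic classes of `A` are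
closed under cup product) and `hWalg` (`W_E ⊗ ℂ ⊆ Nᵏ`). Here:

* `isEvenCupSubalgebra_algebraicClasses` — **`hcup` is a THEOREM for every complex abelian variety** (gen 5 (β),
  `cupProduct_mem_algebraicClasses_abelianVariety`: diagonal pull-back to `A × A` + Kleiman moving lemma; Voisin II
  Prop. 9.20 on the tree's carrier), so the endnote's corollary needs only the fact, its general-member hypotheses
  and the Weil classes.
* `divisorWeilSpan_le_divisorWeilAlgebra` — junction with row T6-F (gen 5 (β)): the cell's span of divisor–Weil
  monomials lies in the literature seat's generated algebra (the converse needs products of Weil classes; not claimed).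
* `weilClassesCMField_isWeilTypeCM` — junction of carriers: Deligne's `IsWeilTypeCM A η R e₀ k` with `e₀ ≥ 2`
  supplies ALL SEVEN hypotheses of rung R3 (`WeilTypeLadder.WeilClassesCMField`) at `(A, η, P_R = R(T²), e = 2e₀,
  m = k)`: `P_R` monic of degree `2e₀ > 2`, irreducible, `P_R(η) = 0`, `2e₀ · 2k = 2 dim A`, no real root (`ρ̄ = -ρ`,
  `ρ ≠ 0` since the roots of `R` are negative), conjugation polynomial `Q = -T`.
* `WeilClassesFieldRationallySpanned` — the ONE typed missing input (ours; NOT a conjecture in print): the tree's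
  spectrally defined `weilClassesField A φ P r ⊆ H^r(A(ℂ); ℂ)` is the complex span of its RATIONAL members. In print
  this is part of the definition (`W_F := ⋀ʳ_F H¹(A, ℚ) ⊂ Hʳ(A, ℚ)`, `W_F ⊗ ℂ = ⊕_σ ⋀ʳ V_{ℂ,σ}`: Moonen–Zarhin §1,
  Deligne (4.4)); for the tree's carrier it is Galois descent (the eigen-subspaces at the roots of `P ∈ ℤ[T]` are
  permuted by `Aut(ℂ/ℚ)`), not yet formalised — its quadratic analogue IS a tree theorem
  (`HodgeTheory.weilClassesOf_eq_span_isRationalClass`, van Geemen 4.9). It is needed because rung R3 and the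
  transport leaves deliver RATIONAL Hodge Weil classes, while `hWalg` asks for the complex subspace.
* `HodgeGeneralWeilTypeCMField` — **typed target T6-CM**: the Hodge conjecture for the general member
  (`HasHodgeGroupSUCM`) of a CM-field Weil family with `[E:ℚ] = 2e₀ ≥ 4`, in Deligne's binders. ON-PATH: a case of
  `HC_AV` / the summit. OPEN in print for every such `E` (Deligne §4–5: these Weil classes are not known to be
  algebraic; Markman arXiv:2509.23079 announces partial degree-4 cases, UNREFEREED).
* `hodgeGeneralWeilTypeCMField_of_weilClassesCMField` — **T6-CM ⟸ R3** granted fact #24 (endnote, unrefereed),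
  Moonen–Zarhin's criterion (refereed named fact) and the descent input; and the class-level converse on general
  members `mem_algebraicClasses_general_of_hodgeGeneralWeilTypeCMField` (so T6-CM ⟺ R3|general members modulo these).
* `HC_GeneralWeilTypeCMField_of_HC_CM` — **row T6-CM**: `HC_CM → CMPointedWeilFamiliesCMField →
  WeilVariationalHodgeCMField → (#24) → (MZ) → (descent) → HodgeGeneralWeilTypeCMField`, by gen 1's
  `HC_WeilClassesCMField_of_HC_CM`; and its `HC_CM`-FREE twin from gen 2's divisor-generated CM-pointed leaf
  (`HC_CM` is NOMINAL on this row too: honest column of RING2-MAP §transport (viii-c)).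

Endnote-dependence (C4). Everything routed through fact #24 inherits its status: UNREFEREED for `[E:ℚ] > 2` (Milne's
endnote; Milne 2025 Example 1.17), refereed for `E` imaginary quadratic (van Geemen 6.12 — but that case, `e₀ = 1`, is
row T6 of gen 3 on van Geemen's carriers and is excluded here by `2 ≤ e₀`, exactly as rung R3 excludes it by `2 < e`).

## References

* [Deligne1982HodgeCycles] P. Deligne, *Hodge cycles on abelian varieties*, LNM 900 (1982), §4 (4.4), Prop. 4.4,
  Milne's 2003 re-edition endnote 16.
* [MoonenZarhin1998WeilClasses] B. Moonen, Yu. Zarhin, *Weil classes on abelian varieties*, Crelle 496 (1998), §1.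
* [vanGeemen1994HodgeAV] B. van Geemen, LNM 1594 (1994), 4.9–4.11, Thm. 6.12.
* [Milne2025AbelianMotivesCharP] J. S. Milne (2025), §1.5 Example 1.17.
* [VoisinHodgeII2003] C. Voisin, *Hodge Theory and Complex Algebraic Geometry II* (2003), Prop. 9.20.
* [Markman2025SecantRealMultiplication] E. Markman, arXiv:2509.23079 (preprint, unrefereed).
* [CharlesSchnell2014Notes] F. Charles, C. Schnell, *Notes on absolute Hodge classes* (2014), Conj. 11.3.1.
-/

noncomputable section

open CategoryTheory

namespace Summit.HodgeConjecture.HodgeConjecture.Ring2Transport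

open Literature.AlgebraicGeometry Literature.AlgebraicGeometry.Motives
open Literature.AlgebraicGeometry.HodgeTheory
open Literature.AlgebraicGeometry.Deligne1982
open Literature.AlgebraicGeometry.VanGeemen1994 (pullbackOne hodgeClassSpan)
open Literature.AlgebraicTopology.SingularHomology
open Literature.Barriers.HodgeConjecture
open Summit.HodgeConjecture.HodgeConjecture.Theses
open Summit.HodgeConjecture.HodgeConjecture.WeilTypeLadder

set_option linter.dupNamespace false

/-! ### §0 The cup-closure hypothesis of the endnote's corollary is a theorem on abelian varieties -/

/-- **`N• H^{2•}(A(ℂ); ℂ)` is an even cup subalgebra** for every complex abelian variety `A`: `1 ∈ N⁰ = H⁰`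
(`algebraicClasses_zero`) and `Nᵖ ⌣ Nᵠ ⊆ N^{p+q}` (the Literature lemma
`HodgeTheory.AbelianVariety.cupProduct_mem_algebraicClasses`, diagonal pull-back + Kleiman moving; gen 6 re-points this
use from the Summit-side copy of gen 5 (β) to the Literature original, so that the copy can be retired — dedup).
This DISCHARGES the hypothesis `hcup` of `Deligne1982_hodgeRing_weilTypeCM_of_hodgeGroupSU.hodgeConjectureFor`.
[cite: VoisinHodgeII2003, Prop. 9.20] [cite: Fulton1998, §19.2 Cor. 19.2 (b) and Appendix B.9.2 (a)] -/
theorem isEvenCupSubalgebra_algebraicClasses (A : AbelianVariety ℂ) :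
    IsEvenCupSubalgebra A.X (fun p ↦ algebraicClasses A.X p) where
  one_mem := by
    show singularCohomology.one ℂ (ComplexPoints A.X) ∈ algebraicClasses A.X 0
    rw [algebraicClasses_zero]
    exact Submodule.mem_top
  cup_mem _ _ _ _ ha hb :=
    Literature.AlgebraicGeometry.HodgeTheory.AbelianVariety.cupProduct_mem_algebraicClasses A ha hb

/-- **The endnote's corollary with `hcup` discharged**: for `(A, η)` of Weil type (CM field `E = ℚ(η)`), general
(`HasHodgeGroupSUCM` at a Rosati-compatible polarization class), GRANTED fact #24, the Hodge conjecture for `A`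
follows from the algebraicity of the complexified Weil classes alone. [cite: Deligne1982HodgeCycles, §4 (4.4) and Milne 2003 re-edition endnote 16]
[cite: Milne2025AbelianMotivesCharP, §1.5 Example 1.17] -/
theorem hodgeConjectureFor_weilTypeCM_of_weilClassesField
    (h24 : Deligne1982_hodgeRing_weilTypeCM_of_hodgeGroupSU) {A : AbelianVariety ℂ} {η : A ⟶ A}
    {R : Polynomial ℤ} {e₀ k : ℕ} {h : complexBetti A.X 2} (hW : IsWeilTypeCM A η R e₀ k)
    (hpol : IsPolarizationClass A.dim A.X h)
    (hRos : ∀ x y : complexBetti A.X 1,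
      polarizationPairingOne A.X h (A.dim - 1) (pullbackOne A η x) y =
        -polarizationPairingOne A.X h (A.dim - 1) x (pullbackOne A η y))
    (hSU : HasHodgeGroupSUCM A η (R.comp (Polynomial.X ^ 2)) h)
    (hWalg : weilClassesField A η (R.comp (Polynomial.X ^ 2)) (2 * k) ≤ algebraicClasses A.X k) :
    HodgeConjectureFor A.dim A.X :=
  h24.hodgeConjectureFor hW hpol hRos hSU (isEvenCupSubalgebra_algebraicClasses A) hWalg

/-! ### §1 Junction with row T6-F: divisor–Weil monomials lie in the generated algebra -/

section Junction

variable {A : AbelianVariety ℂ} {φ : A ⟶ A} {P : Polynomial ℤ} {m : ℕ}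

/-- Every divisor–Weil monomial (gen 5 (β), any number of RATIONAL `(m,m)` Weil factors) lies in every
divisor–Weil family of the literature seat (which contains ALL of `W_F ⊗ ℂ` and is cup-closed). Induction on the
number of Weil factors. [cite: vanGeemen1994HodgeAV, §2.4] [cite: Deligne1982HodgeCycles, Milne 2003 re-edition endnote 16] -/
theorem divisorWeilMonomials_subset_of_isDivisorWeilFamily
    {G : (p : ℕ) → Submodule ℂ (complexBetti A.X (2 * p))} (hG : IsDivisorWeilFamily A φ P m G) :
    ∀ j k, divisorWeilMonomials A φ P m j k ⊆ (G k : Set (complexBetti A.X (2 * k)))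
  | 0, k => divisorMonomials_subset hG k
  | j + 1, k => by
      rintro c ⟨q, hq, a, w, ha, hw, -, -, rfl⟩
      obtain rfl : k = q + m := by omega
      exact hG.cup_mem (divisorWeilMonomials_subset_of_isDivisorWeilFamily hG j q ha) (hG.weilClassesField_le hw)

/-- **`⟨D, W_F⟩ᵖ ⊗ ℂ` (the cell's span, T6-F) `⊆ divisorWeilAlgebra` (the literature seat's generated algebra).**
[cite: vanGeemen1994HodgeAV, §2.4 and Thm. 6.12] [cite: Deligne1982HodgeCycles, Milne 2003 re-edition endnote 16] -/
theorem divisorWeilSpan_le_divisorWeilAlgebra (p : ℕ) :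
    divisorWeilSpan A φ P m p ≤ divisorWeilAlgebra A φ P m p :=
  Submodule.span_le.2 (Set.iUnion_subset fun j ↦
    divisorWeilMonomials_subset_of_isDivisorWeilFamily (isDivisorWeilFamily_divisorWeilAlgebra A φ P m) j p)

end Junction

/-! ### §2 Junction of carriers: Deligne's `IsWeilTypeCM` feeds rung R3 -/

section Carriers

variable {A : AbelianVariety ℂ} {η : A ⟶ A} {R : Polynomial ℤ} {e₀ k : ℕ}

/-- `P_R = R(T²)` has no real root: `ρ̄ = -ρ` and `ρ ≠ 0` (`P_R(0) = R(0) ≠ 0`, the roots of `R` being negative).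
[cite: Deligne1982HodgeCycles, §4 p. 30] -/
theorem conj_ne_self_of_root_weilTypeCM (hW : IsWeilTypeCM A η R e₀ k) {ρ : ℂ}
    (hρ : Polynomial.eval₂ (Int.castRingHom ℂ) ρ (R.comp (Polynomial.X ^ 2)) = 0) :
    starRingEnd ℂ ρ ≠ ρ := by
  intro hfix
  have h0 : ρ = 0 :=
    add_self_eq_zero.1 (eq_neg_iff_add_eq_zero.1 (hfix.symm.trans (hW.conj_eq_neg_of_root hρ)))
  rw [h0, eval₂_comp_X_sq] at hρ
  have hre := (hW.root_real_neg _ hρ).2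
  simp at hre

/-- Complex conjugation acts on the roots of `P_R` through `Q = -T ∈ ℚ[T]`. [cite: Deligne1982HodgeCycles, §4 p. 30] -/
theorem exists_conj_polynomial_weilTypeCM (hW : IsWeilTypeCM A η R e₀ k) :
    ∃ Q : Polynomial ℚ, ∀ ρ : ℂ, Polynomial.eval₂ (Int.castRingHom ℂ) ρ (R.comp (Polynomial.X ^ 2)) = 0 →
      Polynomial.eval₂ (algebraMap ℚ ℂ) ρ Q = starRingEnd ℂ ρ :=
  ⟨-Polynomial.X, fun ρ hρ ↦ by
    rw [Polynomial.eval₂_neg, Polynomial.eval₂_X]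
    exact (hW.conj_eq_neg_of_root hρ).symm⟩

/-- **Rung R3 applies to Deligne's Weil-type CM data with `[E:ℚ] = 2e₀ ≥ 4`**: at `(A, η, P_R = R(T²), e = 2e₀, m = k)`
all seven hypotheses of `WeilTypeLadder.WeilClassesCMField` hold, so R3 makes every RATIONAL `(k,k)` Weil class of
`(A, E)` algebraic. (`e₀ = 1`, `E` imaginary quadratic, is excluded by R3's `2 < e`; that case is rung R∞ / row T6 on
van Geemen's carriers, gen 3.) [cite: Deligne1982HodgeCycles, §4 (4.4)] [cite: MoonenZarhin1998WeilClasses, §1] -/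
theorem weilClassesCMField_isWeilTypeCM (hR3 : WeilClassesCMField) (he : 2 ≤ e₀) (hW : IsWeilTypeCM A η R e₀ k) :
    ∀ c ∈ weilClassesField A η (R.comp (Polynomial.X ^ 2)) (2 * k), IsRationalClass c →
      IsOfHodgeType A.dim A.X (2 * k) k k c → c ∈ algebraicClasses A.X k :=
  hR3 A η (R.comp (Polynomial.X ^ 2)) (2 * e₀) k hW.monic_comp hW.natDegree_comp (by omega) hW.irreducible
    hW.eval₂_eq_zero hW.degree_mul_rank (fun _ hρ ↦ conj_ne_self_of_root_weilTypeCM hW hρ)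
    (exists_conj_polynomial_weilTypeCM hW)

end Carriers

/-! ### §3 The one typed missing input: `weilClassesField` is spanned by its rational members -/

/-- **Descent input (OURS — a typed MISSING INPUT, not a conjecture in print).** For every complex abelian variety `A`,
`φ ∈ End(A)`, `P ∈ ℤ[T]` and degree `r`, the complex subspace `weilClassesField A φ P r ⊆ Hʳ(A(ℂ); ℂ)` (the span over
the complex roots `ρ` of `P` of the simultaneous eigenclass spaces of `ℤ[φ]`, Moonen–Zarhin's `⊕_σ ⋀ʳ V_{ℂ,σ}`) is the
complex span of its RATIONAL members. In print this is immediate from the definition `W_F := ⋀ʳ_F H¹(A, ℚ) ⊂ Hʳ(A, ℚ)`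
with `W_F ⊗ ℂ = ⊕_{σ ∈ Σ_F} ⋀ʳ_ℂ V_{ℂ,σ}` (Moonen–Zarhin §1; Deligne (4.4)); for the tree's spectral carrier it is Galois
descent — the family of eigen-subspaces at the roots of `P` is permuted by `Aut(ℂ/ℚ)`, so their span is defined over
`ℚ` — and is NOT yet a tree theorem (expected provable; the quadratic analogue is
`HodgeTheory.weilClassesOf_eq_span_isRationalClass`, van Geemen 4.9). Tagged as an obligation node so that provers may
discharge it; used below only as an explicit binder. [cite: MoonenZarhin1998WeilClasses, §1 (W_F ⊗ ℂ = ⊕_σ ⋀^r V_{ℂ,σ})]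
[cite: Deligne1982HodgeCycles, §4 (4.4)] [cite: vanGeemen1994HodgeAV, 4.9] [status: ours, expected theorem] -/
@[conjecture] def WeilClassesFieldRationallySpanned : Prop :=
  ∀ (A : AbelianVariety ℂ) (φ : A ⟶ A) (P : Polynomial ℤ) (r : ℕ),
    weilClassesField A φ P r ≤
      Submodule.span ℂ {c | c ∈ weilClassesField A φ P r ∧ IsRationalClass c}

/-- The converse inclusion is trivial, so the descent input says `W ⊗ ℂ = span_ℂ (W ⊗ ℂ)(ℚ)`.
[cite: MoonenZarhin1998WeilClasses, §1] -/
theorem span_rational_le_weilClassesField (A : AbelianVariety ℂ) (φ : A ⟶ A) (P : Polynomial ℤ) (r : ℕ) :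
    Submodule.span ℂ {c | c ∈ weilClassesField A φ P r ∧ IsRationalClass c} ≤ weilClassesField A φ P r :=
  Submodule.span_le.2 fun _ hc ↦ hc.1

/-- Under the descent input, `weilClassesField` EQUALS the span of its rational members. [cite: MoonenZarhin1998WeilClasses, §1] -/
theorem weilClassesField_eq_span_rational (hQ : WeilClassesFieldRationallySpanned) (A : AbelianVariety ℂ)
    (φ : A ⟶ A) (P : Polynomial ℤ) (r : ℕ) :
    weilClassesField A φ P r = Submodule.span ℂ {c | c ∈ weilClassesField A φ P r ∧ IsRationalClass c} :=
  le_antisymm (hQ A φ P r) (span_rational_le_weilClassesField A φ P r)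

/-- **From rational points to the complex subspace**: if `W ⊗ ℂ` is spanned by its rational members, all of type
`(m,m)`, and the rational `(m,m)` members are algebraic, then `W ⊗ ℂ ⊆ Nᵐ` (`algebraicClasses` is a complex subspace).
[cite: vanGeemen1994HodgeAV, 4.9–4.10] [cite: MoonenZarhin1998WeilClasses, §1 (Criterion)] -/
theorem weilClassesField_le_algebraicClasses_of_rationalSpan {A : AbelianVariety ℂ} {φ : A ⟶ A}
    {P : Polynomial ℤ} {m : ℕ}
    (hQ : weilClassesField A φ P (2 * m) ≤
      Submodule.span ℂ {c | c ∈ weilClassesField A φ P (2 * m) ∧ IsRationalClass c})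
    (hH : ∀ c ∈ weilClassesField A φ P (2 * m), IsOfHodgeType A.dim A.X (2 * m) m m c)
    (hR : ∀ c ∈ weilClassesField A φ P (2 * m), IsRationalClass c →
      IsOfHodgeType A.dim A.X (2 * m) m m c → c ∈ algebraicClasses A.X m) :
    weilClassesField A φ P (2 * m) ≤ algebraicClasses A.X m :=
  hQ.trans (Submodule.span_le.2 fun c hc ↦ hR c hc.1 hc.2 (hH c hc.1))

/-- **The `(A, η)`-slice of row T6-CM (no families, no `HC_CM`)**: for `(A, η, R, e₀, k)` of Weil type, general
(`HasHodgeGroupSUCM` at a Rosati-compatible polarization class `h`), GRANTED fact #24 (endnote; UNREFEREED for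
`e₀ ≥ 2`) and Moonen–Zarhin's criterion (the Weil classes are of type `(k,k)`), the descent input at `(A, η, P_R, 2k)`
and the algebraicity of the RATIONAL `(k,k)` Weil classes of THIS pair give `HodgeConjectureFor A.dim A.X`.
[cite: Deligne1982HodgeCycles, §4 (4.4), Prop. 4.4 and Milne 2003 re-edition endnote 16]
[cite: MoonenZarhin1998WeilClasses, §1 (Criterion)] [cite: VoisinHodgeII2003, Prop. 9.20] -/
theorem hodgeConjectureFor_weilTypeCM_of_rational
    (h24 : Deligne1982_hodgeRing_weilTypeCM_of_hodgeGroupSU) (hMZ : MoonenZarhin1998_weilClasses_hodgeCriterion)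
    {A : AbelianVariety ℂ} {η : A ⟶ A} {R : Polynomial ℤ} {e₀ k : ℕ} {h : complexBetti A.X 2}
    (hW : IsWeilTypeCM A η R e₀ k) (hpol : IsPolarizationClass A.dim A.X h)
    (hRos : ∀ x y : complexBetti A.X 1,
      polarizationPairingOne A.X h (A.dim - 1) (pullbackOne A η x) y =
        -polarizationPairingOne A.X h (A.dim - 1) x (pullbackOne A η y))
    (hSU : HasHodgeGroupSUCM A η (R.comp (Polynomial.X ^ 2)) h)
    (hQ : weilClassesField A η (R.comp (Polynomial.X ^ 2)) (2 * k) ≤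
      Submodule.span ℂ {c | c ∈ weilClassesField A η (R.comp (Polynomial.X ^ 2)) (2 * k) ∧ IsRationalClass c})
    (hR : ∀ c ∈ weilClassesField A η (R.comp (Polynomial.X ^ 2)) (2 * k), IsRationalClass c →
      IsOfHodgeType A.dim A.X (2 * k) k k c → c ∈ algebraicClasses A.X k) :
    HodgeConjectureFor A.dim A.X :=
  hodgeConjectureFor_weilTypeCM_of_weilClassesField h24 hW hpol hRos hSU
    (weilClassesField_le_algebraicClasses_of_rationalSpan hQ
      (fun _ hc ↦ hW.isOfHodgeType_of_mem_weilClassesField hMZ hc) hR)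

/-! ### §4 The T6-CM target and the row -/

/-- **T6-CM — the Hodge conjecture for the GENERAL member of a CM-field Weil family, `[E:ℚ] ≥ 4`** (typed target;
Summit-side statement, a CASE of the summit), in Deligne's binders (§lit gen 7): `(A, η, R, e₀, k)` of Weil type
relative to the CM field `E = ℚ(η) ≅ ℚ[T]/(R(T²))`, `[E:ℚ] = 2e₀` with `e₀ ≥ 2`, `dim_E H¹ = 2k`; `h` a polarization
class whose form is alternated by `η` (Rosati `η' = -η`, i.e. `H(x, ηy) ∈ E` is `φ`-sesquilinear); and the special
Mumford–Tate group of `A` is `SU(φ)` (`HasHodgeGroupSUCM`: the GENERAL member of the Weil-type Shimura family;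
Deligne Prop. 4.6 / endnote 16 "for general `(A, ν, λ)` equality holds"). THEN `HodgeConjectureFor A.dim A.X`.
In print: OPEN for every CM field of degree `≥ 4` (Deligne §4–5: the Weil classes are the test case not covered by
any known method; Moonen–Zarhin §1; Markman's secant²/RM programme announces only partial degree-4 cases,
arXiv:2509.23079, unrefereed). ON-PATH (`hodgeGeneralWeilTypeCMField_of_hodgeConjecture`); granted fact #24, MZ and
the descent input it is EQUIVALENT to rung R3 restricted to general members (§4 below).
[cite: Deligne1982HodgeCycles, §4 (4.4), Prop. 4.4, Prop. 4.6 and §5] [cite: MoonenZarhin1998WeilClasses, §1]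
[cite: Markman2025SecantRealMultiplication, Thm. 1.1.2 (preprint, unrefereed)] [status: open] -/
@[conjecture] def HodgeGeneralWeilTypeCMField : Prop :=
  ∀ (A : AbelianVariety ℂ) (η : A ⟶ A) (R : Polynomial ℤ) (e₀ k : ℕ) (h : complexBetti A.X 2),
    2 ≤ e₀ → IsWeilTypeCM A η R e₀ k → IsPolarizationClass A.dim A.X h →
    (∀ x y : complexBetti A.X 1,
      polarizationPairingOne A.X h (A.dim - 1) (pullbackOne A η x) y =
        -polarizationPairingOne A.X h (A.dim - 1) x (pullbackOne A η y)) →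
    HasHodgeGroupSUCM A η (R.comp (Polynomial.X ^ 2)) h → HodgeConjectureFor A.dim A.X

/-- ON-PATH (C6): T6-CM is a case of the summit. [cite: Deligne2000, §1] -/
theorem hodgeGeneralWeilTypeCMField_of_hodgeConjecture (hHC : _root_.HodgeConjecture) :
    HodgeGeneralWeilTypeCMField :=
  fun A _ _ _ _ _ _ _ _ _ _ ↦ hHC (AbelianVariety.isSmoothProjective_holds (A := A))

/-- ON-PATH: T6-CM is a case of `HC_AV` (`Theses.PadicSemiregularLift.HodgeAbelianVarieties`, stmt-HodgeConjecture-1333).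
[cite: Deligne2000, §1] -/
theorem hodgeGeneralWeilTypeCMField_of_hodgeAbelianVarieties (hAV : PadicSemiregularLift.HodgeAbelianVarieties) :
    HodgeGeneralWeilTypeCMField :=
  fun A _ _ _ _ _ _ _ _ _ _ ↦ hAV A

/-- **R3 ⟹ T6-CM** granted fact #24 (endnote, unrefereed for `e₀ ≥ 2`), Moonen–Zarhin's criterion and the descent
input — no families, no `HC_CM`. [cite: Deligne1982HodgeCycles, §4 (4.4) and Milne 2003 re-edition endnote 16]
[cite: MoonenZarhin1998WeilClasses, §1 (Criterion)] -/
theorem hodgeGeneralWeilTypeCMField_of_weilClassesCMField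
    (h24 : Deligne1982_hodgeRing_weilTypeCM_of_hodgeGroupSU) (hMZ : MoonenZarhin1998_weilClasses_hodgeCriterion)
    (hQ : WeilClassesFieldRationallySpanned) (hR3 : WeilClassesCMField) : HodgeGeneralWeilTypeCMField :=
  fun A η R _ k _ he hW hpol hRos hSU ↦
    hodgeConjectureFor_weilTypeCM_of_rational h24 hMZ hW hpol hRos hSU (hQ A η (R.comp (Polynomial.X ^ 2)) (2 * k))
      (weilClassesCMField_isWeilTypeCM hR3 he hW)

/-- **Conversely (class level): T6-CM ⟹ R3 on general members** — under `HodgeGeneralWeilTypeCMField`, every RATIONAL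
Weil class of a general Weil-type `(A, η)` with `e₀ ≥ 2` is algebraic, GRANTED Moonen–Zarhin's criterion (type `(k,k)`).
So, modulo fact #24, MZ and the descent input, T6-CM and R3|general members are EQUIVALENT: the endnote adds exactly
the general-member Hodge-ring statement and nothing towards the Weil classes.
[cite: MoonenZarhin1998WeilClasses, §1 (Criterion)] [cite: Deligne2000, §1] -/
theorem mem_algebraicClasses_general_of_hodgeGeneralWeilTypeCMField (hT : HodgeGeneralWeilTypeCMField)
    (hMZ : MoonenZarhin1998_weilClasses_hodgeCriterion) {A : AbelianVariety ℂ} {η : A ⟶ A} {R : Polynomial ℤ}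
    {e₀ k : ℕ} {h : complexBetti A.X 2} (he : 2 ≤ e₀) (hW : IsWeilTypeCM A η R e₀ k)
    (hpol : IsPolarizationClass A.dim A.X h)
    (hRos : ∀ x y : complexBetti A.X 1,
      polarizationPairingOne A.X h (A.dim - 1) (pullbackOne A η x) y =
        -polarizationPairingOne A.X h (A.dim - 1) x (pullbackOne A η y))
    (hSU : HasHodgeGroupSUCM A η (R.comp (Polynomial.X ^ 2)) h) {c : complexBetti A.X (2 * k)}
    (hc : c ∈ weilClassesField A η (R.comp (Polynomial.X ^ 2)) (2 * k)) (hcQ : IsRationalClass c) :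
    c ∈ algebraicClasses A.X k :=
  mem_algebraicClasses_of_mem_weilClassesField_of_hodgeConjectureFor hMZ hW (hT A η R e₀ k h he hW hpol hRos hSU)
    hc hcQ

/-- **Row T6-CM (the surviving "CM point ⟹ whole family" principle for the GENERAL member, CM field `E` of degree
`≥ 4`): `HC_CM → CMPointedWeilFamiliesCMField → WeilVariationalHodgeCMField → (#24) → (MZ) → (descent) →
HodgeGeneralWeilTypeCMField`.** The CM-pointed Weil families make the Weil classes algebraic at CM members by `HC_CM`
(anchors); the Weil-confined variational Hodge conjecture (OPEN; Charles–Schnell Conj. 11.3.1 confined to flat Weil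
sections — the honest replacement of Markman's Q11.4 sentence 2, refuted in dim ≥ 3) transports them to every member
(gen 1, rung R3 = `HC_WeilClassesCMField_of_HC_CM`); descent + Moonen–Zarhin pass from rational points to
`W_E ⊗ ℂ ⊆ Nᵏ`; the endnote (fact #24) and the cup-closure THEOREM (§0) give the whole Hodge ring of the general
member. CONDITIONAL on all six named hypotheses; `HC_CM` is NOMINAL (next theorem).
[cite: Deligne1982HodgeCycles, §4 (4.4), Prop. 4.4 and Milne 2003 re-edition endnote 16]
[cite: CharlesSchnell2014Notes, Conj. 11.3.1] [cite: MoonenZarhin1998WeilClasses, §1 (Criterion)] -/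
theorem HC_GeneralWeilTypeCMField_of_HC_CM (hCM : Theses.RankFourFaces.CMAbelianHodge)
    (hP : CMPointedWeilFamiliesCMField) (hV : WeilVariationalHodgeCMField)
    (h24 : Deligne1982_hodgeRing_weilTypeCM_of_hodgeGroupSU) (hMZ : MoonenZarhin1998_weilClasses_hodgeCriterion)
    (hQ : WeilClassesFieldRationallySpanned) : HodgeGeneralWeilTypeCMField :=
  hodgeGeneralWeilTypeCMField_of_weilClassesCMField h24 hMZ hQ (HC_WeilClassesCMField_of_HC_CM hCM hP hV)

/-- **Row T6-CM WITHOUT `HC_CM` (load-bearing audit): `DivisorGeneratedCMPointedWeilFamiliesCMField →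
WeilVariationalHodgeCMField → (#24) → (MZ) → (descent) → HodgeGeneralWeilTypeCMField`.** Gen 2's divisor-generated
CM-pointed leaf (every `F`-Weil component contains a diagonal CM member on which `Hdg = Div`) makes the anchors
algebraic with no Hodge-conjecture input: on row T6-CM `HC_CM` is NOMINAL — it can be traded for the choice of a
divisor-generated CM fibre. [cite: Deligne1982HodgeCycles, §5] [cite: vanGeemen1994HodgeAV, 2.4]
[cite: CharlesSchnell2014Notes, Conj. 11.3.1] -/
theorem HC_GeneralWeilTypeCMField_of_divisorGeneratedCMPointed
    (hP : DivisorGeneratedCMPointedWeilFamiliesCMField) (hV : WeilVariationalHodgeCMField)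
    (h24 : Deligne1982_hodgeRing_weilTypeCM_of_hodgeGroupSU) (hMZ : MoonenZarhin1998_weilClasses_hodgeCriterion)
    (hQ : WeilClassesFieldRationallySpanned) : HodgeGeneralWeilTypeCMField :=
  hodgeGeneralWeilTypeCMField_of_weilClassesCMField h24 hMZ hQ
    (HC_WeilClassesCMField_of_divisorGeneratedCMPointed hP hV)

/-- **Where T6-CM sits**: `HC_AV ⟹ T6-CM ⟸ R3` (the latter granted #24, MZ, descent), and under `HC_CM` plus the two
transport leaves the rung R3 is available — the honest reading of row T6-CM is "`HC_CM` nominal; content =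
Weil-confined variational Hodge (ours/open) + Milne's endnote (unrefereed for `[E:ℚ] > 2`) + one descent lemma
(ours, expected)". [cite: Deligne1982HodgeCycles, §4–§5 and Milne 2003 re-edition endnote 16]
[cite: MoonenZarhin1998WeilClasses, §1] -/
theorem hodgeGeneralWeilTypeCMField_position :
    (PadicSemiregularLift.HodgeAbelianVarieties → HodgeGeneralWeilTypeCMField) ∧
      (Deligne1982_hodgeRing_weilTypeCM_of_hodgeGroupSU → MoonenZarhin1998_weilClasses_hodgeCriterion →
        WeilClassesFieldRationallySpanned → WeilClassesCMField → HodgeGeneralWeilTypeCMField) ∧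
      (Theses.RankFourFaces.CMAbelianHodge → CMPointedWeilFamiliesCMField → WeilVariationalHodgeCMField →
        Deligne1982_hodgeRing_weilTypeCM_of_hodgeGroupSU → MoonenZarhin1998_weilClasses_hodgeCriterion →
        WeilClassesFieldRationallySpanned → HodgeGeneralWeilTypeCMField) :=
  ⟨hodgeGeneralWeilTypeCMField_of_hodgeAbelianVarieties, hodgeGeneralWeilTypeCMField_of_weilClassesCMField,
    HC_GeneralWeilTypeCMField_of_HC_CM⟩

end Summit.HodgeConjecture.HodgeConjecture.Ring2Transport

end
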